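import Summits.AnomalousDissipation.AnomalousDissipation.Theorems.SawtoothPulseCascadeK1LocalisedCascadeFibreWindow

/-!
# K1loc, line `Spectral` / thin start — helper: TRACKED ENERGIES ARE `L²`-STABLE (transfer of a start bound between two cascades)

Helper file of the prover lane on the crux `K1LocalisedCascade` (stmt-AnomalousDissipation-19491), route
`SawtoothPulseCascade` (S-B ↔ S-D glue for the START of the ledger).  The ledger's classes (strip, off-cone, shell, …) are weighted
spectral energies `Σ'_k w(k)‖𝓕u(k)‖²` with indicator weights `0 ≤ w ≤ 1`; a start bound proved or certified for ONE function `u⁰`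
(e.g. the exact-sawtooth iterate) transfers to any `L²`-close function `u` (e.g. the rounded iterate, `…ShearStability[Cascade]`):
* `tsum_weight_mul_add_sq_le` — weighted `ℓ²`-Minkowski for `tsum`s: `Σ' w(a+b)² ≤ (√Σ'wa² + √Σ'wb²)²` (`w, a, b ≥ 0`);
* **`sqrt_tsum_weight_le_add_sqrt_integral`** — for `f, g` continuous on `T^d` and `0 ≤ w ≤ 1`:
  `√(Σ' w‖𝓕f‖²) ≤ √(Σ' w‖𝓕g‖²) + √(∫‖f − g‖²)`, and the energy form `tsum_weight_le_sq_sqrt_add`.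
No definitions; no statement about the crux. [cite: Grafakos2014, Prop. 3.1.2 (5) and Prop. 3.2.7 (3)] [problem: turb]
-/

-- `Summit.<Summit>.<Problem>`: single-conjunct summit, the duplicate namespace segment is deliberate.
set_option linter.dupNamespace false

noncomputable section

namespace Summit.AnomalousDissipation.AnomalousDissipation.Theorems.SawtoothPulseCascade.K1Start

open MeasureTheory Set Filter Topology UnitAddTorus Function
open Literature.Analysis.FunctionSpaces Literature.Analysis.FunctionSpaces.Torus
open Summit.AnomalousDissipation.AnomalousDissipation.Theorems.SawtoothPulseCascade.SpectralLeakage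

/-! ## §1 Weighted `ℓ²`-Minkowski for `tsum`s -/

/-- **Weighted Minkowski, `tsum` form**: for `w, a, b ≥ 0` with `Σ' w a²`, `Σ' w b²` summable,
`Σ' w(a+b)²` is summable and `≤ (√(Σ' w a²) + √(Σ' w b²))²`. [folklore] -/
theorem tsum_weight_mul_add_sq_le {ι : Type*} {w a b : ι → ℝ} (hw : ∀ i, 0 ≤ w i) (ha : ∀ i, 0 ≤ a i) (hb : ∀ i, 0 ≤ b i)
    (hsa : Summable fun i => w i * a i ^ 2) (hsb : Summable fun i => w i * b i ^ 2) :
    (Summable fun i => w i * (a i + b i) ^ 2) ∧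
      ∑' i, w i * (a i + b i) ^ 2 ≤ (Real.sqrt (∑' i, w i * a i ^ 2) + Real.sqrt (∑' i, w i * b i ^ 2)) ^ 2 := by
  have hnn : ∀ i, 0 ≤ w i * (a i + b i) ^ 2 := fun i => mul_nonneg (hw i) (sq_nonneg _)
  have hdom : ∀ i, w i * (a i + b i) ^ 2 ≤ 2 * (w i * a i ^ 2) + 2 * (w i * b i ^ 2) := fun i => by
    nlinarith [hw i, sq_nonneg (a i - b i), mul_nonneg (hw i) (sq_nonneg (a i - b i))]
  have hS : Summable fun i => w i * (a i + b i) ^ 2 :=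
    ((hsa.mul_left 2).add (hsb.mul_left 2)).of_nonneg_of_le hnn hdom
  refine ⟨hS, ?_⟩
  refine hS.tsum_le_of_sum_le fun s => ?_
  -- finite Minkowski with `√w·a`, `√w·b`
  have hfin := sqrt_sum_add_sq_le s (a := fun i => Real.sqrt (w i) * a i) (b := fun i => Real.sqrt (w i) * b i)
    (fun i _ => mul_nonneg (Real.sqrt_nonneg _) (ha i)) (fun i _ => mul_nonneg (Real.sqrt_nonneg _) (hb i))
  have e0 : ∀ i, (Real.sqrt (w i) * a i + Real.sqrt (w i) * b i) ^ 2 = w i * (a i + b i) ^ 2 := fun i => by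
    rw [← mul_add, mul_pow, Real.sq_sqrt (hw i)]
  have ea : ∀ i, (Real.sqrt (w i) * a i) ^ 2 = w i * a i ^ 2 := fun i => by rw [mul_pow, Real.sq_sqrt (hw i)]
  have eb : ∀ i, (Real.sqrt (w i) * b i) ^ 2 = w i * b i ^ 2 := fun i => by rw [mul_pow, Real.sq_sqrt (hw i)]
  simp only [e0, ea, eb] at hfin
  have hA : Real.sqrt (∑ i ∈ s, w i * a i ^ 2) ≤ Real.sqrt (∑' i, w i * a i ^ 2) :=
    Real.sqrt_le_sqrt (hsa.sum_le_tsum s fun i _ => mul_nonneg (hw i) (sq_nonneg _))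
  have hB : Real.sqrt (∑ i ∈ s, w i * b i ^ 2) ≤ Real.sqrt (∑' i, w i * b i ^ 2) :=
    Real.sqrt_le_sqrt (hsb.sum_le_tsum s fun i _ => mul_nonneg (hw i) (sq_nonneg _))
  have h0 : 0 ≤ ∑ i ∈ s, w i * (a i + b i) ^ 2 := Finset.sum_nonneg fun i _ => hnn i
  calc ∑ i ∈ s, w i * (a i + b i) ^ 2 = (Real.sqrt (∑ i ∈ s, w i * (a i + b i) ^ 2)) ^ 2 := (Real.sq_sqrt h0).symm
    _ ≤ (Real.sqrt (∑ i ∈ s, w i * a i ^ 2) + Real.sqrt (∑ i ∈ s, w i * b i ^ 2)) ^ 2 :=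
        pow_le_pow_left₀ (Real.sqrt_nonneg _) hfin 2
    _ ≤ (Real.sqrt (∑' i, w i * a i ^ 2) + Real.sqrt (∑' i, w i * b i ^ 2)) ^ 2 :=
        pow_le_pow_left₀ (add_nonneg (Real.sqrt_nonneg _) (Real.sqrt_nonneg _)) (add_le_add hA hB) 2

/-! ## §2 Tracked energies of two `L²`-close functions -/

section Torus

variable {d : Type*} [Fintype d]

/-- **Tracked energies are `L²`-stable**: for `f, g` continuous on `T^d` and a weight `0 ≤ w ≤ 1`,
`√(Σ'_k w(k)‖𝓕f(k)‖²) ≤ √(Σ'_k w(k)‖𝓕g(k)‖²) + √(∫‖f − g‖²)` (`𝓕f = 𝓕g + 𝓕(f−g)`, weighted Minkowski, Parseval for `f − g`).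
[cite: Grafakos2014, Prop. 3.1.2 (5) and Prop. 3.2.7 (3)] -/
theorem sqrt_tsum_weight_le_add_sqrt_integral {f g : UnitAddTorus d → ℂ} (hf : Continuous f) (hg : Continuous g)
    {w : (d → ℤ) → ℝ} (hw0 : ∀ k, 0 ≤ w k) (hw1 : ∀ k, w k ≤ 1) :
    Real.sqrt (∑' k, w k * ‖mFourierCoeff f k‖ ^ 2) ≤
      Real.sqrt (∑' k, w k * ‖mFourierCoeff g k‖ ^ 2) + Real.sqrt (∫ x, ‖f x - g x‖ ^ 2) := by
  have hfg : Continuous fun x => f x - g x := hf.sub hg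
  -- Parseval for `f − g`
  have hPd := hasSum_sq_mFourierCoeff_of_continuous hfg
  -- coefficientwise: `𝓕f = 𝓕g + 𝓕(f − g)`
  have hcoef : ∀ k, ‖mFourierCoeff f k‖ ≤ ‖mFourierCoeff g k‖ + ‖mFourierCoeff (fun x => f x - g x) k‖ := by
    intro k
    have e : mFourierCoeff f k = mFourierCoeff g k + mFourierCoeff (fun x => f x - g x) k := by
      have h := Torus.mFourierCoeff_add (F := ℂ) hg.integrable_unitAddTorus hfg.integrable_unitAddTorus k
      have hsum : (g + fun x => f x - g x) = f := by funext x; simp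
      rw [hsum] at h
      exact h
    rw [e]; exact norm_add_le _ _
  -- weighted summability
  have hwf : ∀ {u : UnitAddTorus d → ℂ}, Continuous u → Summable fun k : d → ℤ => w k * ‖mFourierCoeff u k‖ ^ 2 :=
    fun hu => (hasSum_sq_mFourierCoeff_of_continuous hu).summable.of_nonneg_of_le
      (fun k => mul_nonneg (hw0 k) (sq_nonneg _))
      (fun k => (mul_le_of_le_one_left (sq_nonneg _) (hw1 k)))
  have hMink := tsum_weight_mul_add_sq_le hw0 (fun k => norm_nonneg (mFourierCoeff g k))
    (fun k => norm_nonneg (mFourierCoeff (fun x => f x - g x) k)) (hwf hg) (hwf hfg)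
  -- `Σ' w‖𝓕f‖² ≤ Σ' w(‖𝓕g‖ + ‖𝓕(f−g)‖)²`
  have h1 : ∑' k, w k * ‖mFourierCoeff f k‖ ^ 2 ≤
      ∑' k, w k * (‖mFourierCoeff g k‖ + ‖mFourierCoeff (fun x => f x - g x) k‖) ^ 2 :=
    (hwf hf).tsum_le_tsum (fun k => mul_le_mul_of_nonneg_left
      (pow_le_pow_left₀ (norm_nonneg _) (hcoef k) 2) (hw0 k)) hMink.1
  -- `Σ' w‖𝓕(f−g)‖² ≤ ∫‖f−g‖²`
  have h2 : ∑' k, w k * ‖mFourierCoeff (fun x => f x - g x) k‖ ^ 2 ≤ ∫ x, ‖f x - g x‖ ^ 2 := by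
    rw [← hPd.tsum_eq]
    exact (hwf hfg).tsum_le_tsum (fun k => mul_le_of_le_one_left (sq_nonneg _) (hw1 k)) hPd.summable
  calc Real.sqrt (∑' k, w k * ‖mFourierCoeff f k‖ ^ 2)
      ≤ Real.sqrt ((Real.sqrt (∑' k, w k * ‖mFourierCoeff g k‖ ^ 2) +
          Real.sqrt (∑' k, w k * ‖mFourierCoeff (fun x => f x - g x) k‖ ^ 2)) ^ 2) :=
        Real.sqrt_le_sqrt (h1.trans hMink.2)
    _ = Real.sqrt (∑' k, w k * ‖mFourierCoeff g k‖ ^ 2) +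
          Real.sqrt (∑' k, w k * ‖mFourierCoeff (fun x => f x - g x) k‖ ^ 2) :=
        Real.sqrt_sq (add_nonneg (Real.sqrt_nonneg _) (Real.sqrt_nonneg _))
    _ ≤ _ := add_le_add le_rfl (Real.sqrt_le_sqrt h2)

/-- **Energy form**: `Σ' w‖𝓕f‖² ≤ (√(Σ' w‖𝓕g‖²) + √(∫‖f − g‖²))²` for `f, g` continuous and `0 ≤ w ≤ 1` — a certified or proved
start bound for `g` (e.g. the exact-sawtooth iterate) plus an `L²` comparison `‖f − g‖₂ ≤ η` (`…ShearStabilityCascade`) give the start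
bound for `f`. [cite: Grafakos2014, Prop. 3.2.7 (3)] -/
theorem tsum_weight_le_sq_sqrt_add {f g : UnitAddTorus d → ℂ} (hf : Continuous f) (hg : Continuous g)
    {w : (d → ℤ) → ℝ} (hw0 : ∀ k, 0 ≤ w k) (hw1 : ∀ k, w k ≤ 1) {S η : ℝ}
    (hS : ∑' k, w k * ‖mFourierCoeff g k‖ ^ 2 ≤ S) (hη : Real.sqrt (∫ x, ‖f x - g x‖ ^ 2) ≤ η) :
    ∑' k, w k * ‖mFourierCoeff f k‖ ^ 2 ≤ (Real.sqrt S + η) ^ 2 := by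
  have h := sqrt_tsum_weight_le_add_sqrt_integral hf hg hw0 hw1
  have h0 : 0 ≤ ∑' k, w k * ‖mFourierCoeff f k‖ ^ 2 := tsum_nonneg fun k => mul_nonneg (hw0 k) (sq_nonneg _)
  have hη0 : 0 ≤ η := (Real.sqrt_nonneg _).trans hη
  have hle : Real.sqrt (∑' k, w k * ‖mFourierCoeff f k‖ ^ 2) ≤ Real.sqrt S + η :=
    h.trans (add_le_add (Real.sqrt_le_sqrt hS) hη)
  calc ∑' k, w k * ‖mFourierCoeff f k‖ ^ 2 = (Real.sqrt (∑' k, w k * ‖mFourierCoeff f k‖ ^ 2)) ^ 2 := (Real.sq_sqrt h0).symm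
    _ ≤ (Real.sqrt S + η) ^ 2 := pow_le_pow_left₀ (Real.sqrt_nonneg _) hle 2

end Torus

end Summit.AnomalousDissipation.AnomalousDissipation.Theorems.SawtoothPulseCascade.K1Start
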